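import Literature.Computability.QuantumComplexity.FactoringNP
import Literature.Computability.QuantumComplexity.PrattMachine
import HarnessLib

/-!
# Factoring is in `NP ∩ coNP`; `PRIMES ∈ NP` (Pratt)

Family `PQC`, companion of `Factoring.lean` (the fact `FACT_mem_NP_inter_coNP`, pqc.S26) and
`FactoringNP.lean` (`FACT_mem_NP`, the easy half). Here the `coNP` half and the discharge:

* `FactCoVer ∈ P` (internals in the sub-namespace `FactCoNP`) — the verifier of NON-membership in `FACT = {⟨N, k⟩ : ∃ d, 1 < d ≤ k ∧ d ∣ N}`:
  accept `⟨x, y⟩` iff `x` is not the code of a pair of numerals, or `N = 0 ∧ k ≤ 1`, or `y = ⟨ps, Ls⟩`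
  where `ps` is a list of numerals with `∏ ps = N ≥ 1`, each `> k` and each certified prime by the
  Pratt certificate `Ls` (`certTestFn` of `PrattMachine.lean`); assembled in the `FP` brick algebra,
  so polynomial time on Mathlib's `Turing.FinTM2` is inherited (`mem_P_of_mem_FP`);
* `FACT_mem_coNP : FACT ∈ coNP` — soundness by `Pratt.CertValid.prime_of_mem_heads` (every prime
  divisor of `N` is one of the certified `ps`, hence `> k`); completeness with the certificate
  `factCert N = ⟨primeFactorsList N, ⋃ Pratt.lines p⟩` of length `≤ 82 (|x| + 1)³`
  (`length_factCert_le`);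
* **`FACT_mem_NP_inter_coNP_holds : FACT_mem_NP_inter_coNP`** (pqc.S26 discharged);
* `PRIMES_mem_NP : PRIMES ∈ NP` — Pratt's theorem itself, with the same machinery (verifier
  `PrimesVer`, internals in `PrimesNP`).

## References

* V. Pratt, *Every prime has a succinct certificate*, SIAM J. Comput. 4 (1975) 214–220.
* S. Arora, B. Barak, *Computational Complexity: A Modern Approach*, CUP 2009, §2.1: Example 2.3
  (p. 40, "Factoring … is in NP by using the primality certificate of Exercise 2.5"), Exercise 2.5
  [Pra75] (`PRIMES ∈ NP`), Def. 2.1, Def. 2.19 (`coNP`).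
* R. Crandall, C. Pomerance, *Prime numbers: a computational perspective*, Springer, §4.1.3, Thm 4.1.9.
-/

namespace Literature.Computability.QuantumComplexity

open _root_.Computability Complexity Complexity.Classes Complexity.Nondeterministic Complexity.Brick Polynomial
open Literature.NumberTheory.Primality PrattMachine

/-! ### The arithmetic of non-membership -/

/-- **No small divisor from a certified factorisation**: if `N = ∏ ps` with every `p ∈ ps` a prime
`> k`, then `N` has no divisor `1 < d ≤ k`. [cite: AroraBarakCC2009, Example 2.3] -/
theorem not_dvd_of_prime_factorisation {N k : ℕ} {ps : List ℕ} (hprod : ps.prod = N)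
    (hps : ∀ p ∈ ps, k < p ∧ p.Prime) {d : ℕ} (h1 : 1 < d) (hdk : d ≤ k) : ¬ d ∣ N := by
  intro hdN
  obtain ⟨r, hr, hrd⟩ := Nat.exists_prime_and_dvd (show d ≠ 1 by omega)
  have hrN : r ∣ ps.prod := hprod ▸ hrd.trans hdN
  have hrmem : r ∈ ps := mem_list_primes_of_dvd_prod hr.prime (fun p hp => (hps p hp).2.prime) hrN
  have := (hps r hrmem).1
  have := Nat.le_of_dvd (by omega) hrd
  omega

/-- `(0, k) ∈ factSet ↔ 2 ≤ k` (every `d` divides `0`). [folklore] -/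
theorem zero_mem_factSet_iff (k : ℕ) : ((0, k) ∈ factSet) ↔ 2 ≤ k := by
  rw [mem_factSet_iff]
  constructor
  · rintro ⟨d, h1, hdk, -⟩; omega
  · intro hk; exact ⟨2, by omega, hk, dvd_zero 2⟩

/-! ### The verifier of non-membership -/

namespace FactCoNP

/-- Projections of the verifier's input `w = ⟨⟨a, b⟩, ⟨PL, Ls⟩⟩`: the numeral of `N`. [folklore] -/
noncomputable def wA : List Bool → List Bool := fstF ∘ fstF
/-- The numeral of `k`. [folklore] -/
noncomputable def wB : List Bool → List Bool := sndF ∘ fstF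
/-- The coded list of claimed prime factors. [folklore] -/
noncomputable def wPL : List Bool → List Bool := fstF ∘ sndF
/-- The coded Pratt certificate. [folklore] -/
noncomputable def wLs : List Bool → List Bool := sndF ∘ sndF

/-- **The factor test** `pTestFn ⟨⟨b, Ls⟩, ps⟩`: `⟦b⟧ < ⟦ps⟧` and `⟦ps⟧` is certified by `Ls`.
[cite: AroraBarakCC2009, Example 2.3] -/
noncomputable def pTestFn : List Bool → List Bool :=
  andFn (ltFn ∘ fanoutFn (fstF ∘ fstF) sndF) (memHeadFn ∘ fanoutFn sndF (sndF ∘ fstF))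

/-- `pTestFn ∈ FP`. [folklore] -/
theorem pTestFn_mem_FP : pTestFn ∈ FP :=
  andFn_mem_FP (comp_mem_FP ltFn_mem_FP (fanoutFn_mem_FP (comp_mem_FP fstF_mem_FP fstF_mem_FP) sndF_mem_FP))
    (comp_mem_FP memHeadFn_mem_FP (fanoutFn_mem_FP sndF_mem_FP (comp_mem_FP sndF_mem_FP fstF_mem_FP)))

/-- `pTestFn` is one-bit. [folklore] -/
theorem oneBit_pTestFn : OneBit pTestFn := oneBit_andFn (oneBit_ltFn.comp _) (oneBit_memHeadFn.comp _)

/-- Truth of the factor test. [folklore] -/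
theorem pTestFn_eq_true_iff (b Ls ps : List Bool) :
    pTestFn (boolPair (boolPair b Ls) ps) = [true] ↔
      bitsToNat b < bitsToNat ps ∧ bitsToNat ps ∈ Pratt.heads (linesOf Ls) := by
  rw [pTestFn, andFn_eq_true_iff (oneBit_ltFn.comp _) (oneBit_memHeadFn.comp _)]
  simp only [Function.comp_apply, fanoutFn_apply, fstF_boolPair, sndF_boolPair, ltFn_eq_true_iff,
    memHeadFn_eq_true_iff, mem_heads_linesOf_iff]

/-- **The certificate test** for `N ≥ 1`: `0 < N`, `∏ PL = N`, every `ps ∈ PL` passes the factor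
test, and `Ls` is a valid Pratt certificate. [cite: AroraBarakCC2009, Example 2.3] -/
noncomputable def factCertFn : List Bool → List Bool :=
  andFn (ltFn ∘ fanoutFn (fun _ => []) wA)
    (andFn (eqValFn ∘ fanoutFn (prodListFn ∘ fanoutFn (fun _ => []) wPL) wA)
      (andFn (allFn pTestFn ∘ fanoutFn (fanoutFn wB wLs) wPL) (certTestFn ∘ wLs)))

/-- `factCertFn ∈ FP`. [cite: AroraBarakCC2009, §1.3] -/
theorem factCertFn_mem_FP : factCertFn ∈ FP := by
  have hA : wA ∈ FP := comp_mem_FP fstF_mem_FP fstF_mem_FP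
  have hB : wB ∈ FP := comp_mem_FP sndF_mem_FP fstF_mem_FP
  have hPL : wPL ∈ FP := comp_mem_FP fstF_mem_FP sndF_mem_FP
  have hLs : wLs ∈ FP := comp_mem_FP sndF_mem_FP sndF_mem_FP
  exact andFn_mem_FP (comp_mem_FP ltFn_mem_FP (fanoutFn_mem_FP (const_mem_FP _) hA))
    (andFn_mem_FP (comp_mem_FP eqValFn_mem_FP (fanoutFn_mem_FP (comp_mem_FP prodListFn_mem_FP (fanoutFn_mem_FP (const_mem_FP _) hPL)) hA))
      (andFn_mem_FP (comp_mem_FP (allFn_mem_FP pTestFn_mem_FP oneBit_pTestFn) (fanoutFn_mem_FP (fanoutFn_mem_FP hB hLs) hPL))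
        (comp_mem_FP certTestFn_mem_FP hLs)))

/-- `factCertFn` is one-bit. [folklore] -/
theorem oneBit_factCertFn : OneBit factCertFn :=
  oneBit_andFn (oneBit_ltFn.comp _) (oneBit_andFn (oneBit_eqValFn.comp _)
    (oneBit_andFn ((oneBit_allFn oneBit_pTestFn).comp _) (oneBit_certTestFn.comp _)))

/-- **Truth of the certificate test**, on `⟨⟨a, b⟩, y⟩` with an arbitrary certificate string `y`.
[cite: AroraBarakCC2009, Example 2.3] -/
theorem factCertFn_eq_true_iff (a b y : List Bool) :
    factCertFn (boolPair (boolPair a b) y) = [true] ↔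
      0 < bitsToNat a ∧ ((decNil (fstF y)).map bitsToNat).prod = bitsToNat a ∧
        (∀ ps ∈ decNil (fstF y), bitsToNat b < bitsToNat ps ∧ bitsToNat ps ∈ Pratt.heads (linesOf (sndF y))) ∧
        Pratt.CertValid (linesOf (sndF y)) := by
  rw [factCertFn, andFn_eq_true_iff (oneBit_ltFn.comp _) (oneBit_andFn (oneBit_eqValFn.comp _)
      (oneBit_andFn ((oneBit_allFn oneBit_pTestFn).comp _) (oneBit_certTestFn.comp _))),
    andFn_eq_true_iff (oneBit_eqValFn.comp _) (oneBit_andFn ((oneBit_allFn oneBit_pTestFn).comp _) (oneBit_certTestFn.comp _)),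
    andFn_eq_true_iff ((oneBit_allFn oneBit_pTestFn).comp _) (oneBit_certTestFn.comp _)]
  simp only [Function.comp_apply, fanoutFn_apply, wA, wB, wPL, wLs, fstF_boolPair, sndF_boolPair,
    ltFn_eq_true_iff, eqValFn_eq_true_iff, allFn_eq_true_iff oneBit_pTestFn, pTestFn_eq_true_iff,
    certTestFn_eq_true_iff, prodListFn_boolPair, bitsToNat_encodeNat, bitsToNat_nil]

/-- The validity test of the instance: `[x = renormFn x]` (`x` codes a pair of numerals,
`eq_renorm_iff`). [folklore] -/
noncomputable def validXFn : List Bool → List Bool := eqPairFn ∘ fanoutFn fstF (renormFn ∘ fstF)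

/-- The test of the degenerate instances `N = 0 ∧ k ≤ 1` (every `d` divides `0`). [folklore] -/
noncomputable def zeroCaseFn : List Bool → List Bool :=
  andFn (notFn (ltFn ∘ fanoutFn (fun _ => []) wA)) (ltFn ∘ fanoutFn wB (fun _ => encodeNat 2))

/-- **The verifier of non-membership in `FACT`**: the instance is malformed, or degenerate with
`k ≤ 1`, or the certificate test passes. [cite: AroraBarakCC2009, Example 2.3] -/
noncomputable def factCoVerFn : List Bool → List Bool := orFn (notFn validXFn) (orFn zeroCaseFn factCertFn)

/-- `factCoVerFn ∈ FP`. [cite: AroraBarakCC2009, §1.3] -/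
theorem factCoVerFn_mem_FP : factCoVerFn ∈ FP := by
  have hA : wA ∈ FP := comp_mem_FP fstF_mem_FP fstF_mem_FP
  have hB : wB ∈ FP := comp_mem_FP sndF_mem_FP fstF_mem_FP
  refine orFn_mem_FP (notFn_mem_FP (comp_mem_FP eqPairFn_mem_FP (fanoutFn_mem_FP fstF_mem_FP (comp_mem_FP renormFn_mem_FP fstF_mem_FP))))
    (orFn_mem_FP (andFn_mem_FP (notFn_mem_FP (comp_mem_FP ltFn_mem_FP (fanoutFn_mem_FP (const_mem_FP _) hA)))
      (comp_mem_FP ltFn_mem_FP (fanoutFn_mem_FP hB (const_mem_FP _)))) factCertFn_mem_FP)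

/-- `validXFn` is one-bit. [folklore] -/
theorem oneBit_validXFn : OneBit validXFn := oneBit_eqPairFn.comp _

/-- `zeroCaseFn` is one-bit. [folklore] -/
theorem oneBit_zeroCaseFn : OneBit zeroCaseFn := oneBit_andFn (oneBit_notFn (oneBit_ltFn.comp _)) (oneBit_ltFn.comp _)

/-- `factCoVerFn` is one-bit. [folklore] -/
theorem oneBit_factCoVerFn : OneBit factCoVerFn :=
  oneBit_orFn (oneBit_notFn oneBit_validXFn) (oneBit_orFn oneBit_zeroCaseFn oneBit_factCertFn)

/-- **Truth of the verifier on a pair.** [cite: AroraBarakCC2009, Example 2.3] -/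
theorem factCoVerFn_eq_true_iff (x y : List Bool) :
    factCoVerFn (boolPair x y) = [true] ↔
      ¬ x = renormFn x ∨ (bitsToNat (fstF x) = 0 ∧ bitsToNat (sndF x) < 2) ∨ factCertFn (boolPair x y) = [true] := by
  rw [factCoVerFn, orFn_eq_true_iff (oneBit_notFn oneBit_validXFn) (oneBit_orFn oneBit_zeroCaseFn oneBit_factCertFn),
    orFn_eq_true_iff oneBit_zeroCaseFn oneBit_factCertFn, notFn_eq_true_iff oneBit_validXFn, zeroCaseFn,
    andFn_eq_true_iff (oneBit_notFn (oneBit_ltFn.comp _)) (oneBit_ltFn.comp _), notFn_eq_true_iff (oneBit_ltFn.comp _)]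
  simp only [validXFn, Function.comp_apply, fanoutFn_apply, fstF_boolPair, eqPairFn_boolPair, wA, wB,
    ltFn_eq_true_iff, bitsToNat_nil, bitsToNat_encodeNat, List.singleton_inj, decide_eq_true_eq,
    Nat.pos_iff_ne_zero, not_not]

/-! ### The certificate of non-membership and its length -/

/-- **The certificate of `N ≥ 1`**: the prime factorisation of `N` (numerals) and the union of the
Pratt certificates of its primes. [cite: AroraBarakCC2009, Example 2.3] -/
noncomputable def factCert (N : ℕ) : List Bool :=
  boolPair (encList (N.primeFactorsList.map encodeNat)) (encLines (N.primeFactorsList.flatMap Pratt.lines))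

/-- The code of a union of certificates is as long as the codes of the parts together. [folklore] -/
theorem length_encLines_flatMap (ps : List ℕ) :
    (encLines (ps.flatMap Pratt.lines)).length = (ps.map fun p => (encLines (Pratt.lines p)).length).sum := by
  induction ps with
  | nil => simp [encLines]
  | cons p ps ih =>
    simp only [List.flatMap_cons, List.map_cons, List.sum_cons, ← ih]
    simp [encLines, length_encList, List.map_append, List.sum_append]

/-- **The certificate is succinct**: `|factCert N| ≤ 48 s³ + 20 s² + 12 s + 2` with `s = size N`.
[cite: CrandallPomerance1999, Thm 4.1.9] -/
theorem length_factCert_le {N : ℕ} (hN : N ≠ 0) :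
    (factCert N).length ≤ 48 * N.size ^ 3 + 20 * N.size ^ 2 + 12 * N.size + 2 := by
  have hsz := Pratt.sum_size_primeFactorsList_lt hN
  have hlen := Pratt.length_primeFactorsList_lt_size hN
  -- the list of primes
  have h1 : (encList (N.primeFactorsList.map encodeNat)).length ≤ 6 * N.size := by
    rw [length_encList_map_encodeNat]
    have : ∀ qs : List ℕ, (qs.map fun q => 2 * q.size + 2).sum = 2 * (qs.map Nat.size).sum + 2 * qs.length := by
      intro qs
      induction qs with
      | nil => simp
      | cons q qs ih => simp only [List.map_cons, List.sum_cons, List.length_cons, ih]; ring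
    rw [this]
    omega
  -- the Pratt certificates
  have h2 : (encLines (N.primeFactorsList.flatMap Pratt.lines)).length ≤ N.size * (2 * N.size * (24 * N.size + 10)) := by
    rw [length_encLines_flatMap]
    have key : ∀ ps : List ℕ, (∀ p ∈ ps, p.Prime ∧ p ≤ N) →
        (ps.map fun p => (encLines (Pratt.lines p)).length).sum ≤ ps.length * (2 * N.size * (24 * N.size + 10)) := by
      intro ps
      induction ps with
      | nil => intro; simp
      | cons p ps ih =>
        intro h
        obtain ⟨hp, hpN⟩ := h p List.mem_cons_self
        have e1 := length_encLines_lines_le hp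
        have e2 : p.size ≤ N.size := Nat.size_le_size hpN
        have e3 := ih fun q hq => h q (List.mem_cons_of_mem _ hq)
        have e4 : 2 * p.size * (24 * p.size + 10) ≤ 2 * N.size * (24 * N.size + 10) :=
          Nat.mul_le_mul (Nat.mul_le_mul_left 2 e2) (by omega)
        simp only [List.map_cons, List.sum_cons, List.length_cons]
        nlinarith
    refine (key _ fun p hp => ⟨Nat.prime_of_mem_primeFactorsList hp, Nat.le_of_mem_primeFactorsList hp⟩).trans ?_
    exact Nat.mul_le_mul_right _ hlen.le
  rw [factCert, length_boolPair]
  nlinarith [h1, h2]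

/-- The length bound as a polynomial in the instance length. [folklore] -/
noncomputable def factCertPoly : Polynomial ℕ := 82 * (X + 1) ^ 3

/-- `|factCert N| ≤ factCertPoly (|x|)` whenever `size N ≤ |x|`. [folklore] -/
theorem length_factCert_le_eval {N n : ℕ} (hN : N ≠ 0) (hn : N.size ≤ n) :
    (factCert N).length ≤ factCertPoly.eval n := by
  have h := length_factCert_le hN
  simp only [factCertPoly, eval_mul, eval_pow, eval_add, eval_X, eval_one, eval_ofNat]
  have h3 : N.size ^ 3 ≤ n ^ 3 := Nat.pow_le_pow_left hn 3
  have h2 : N.size ^ 2 ≤ n ^ 2 := Nat.pow_le_pow_left hn 2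
  nlinarith

/-- **The certificate passes**: for `N ≥ 1` with no divisor `1 < d ≤ k`, the certificate test
accepts `⟨⟨N, k⟩, factCert N⟩`. [cite: AroraBarakCC2009, Example 2.3] -/
theorem factCertFn_factCert {N k : ℕ} (hN : N ≠ 0) (hNk : (N, k) ∉ factSet) :
    factCertFn (boolPair (boolPair (encodeNat N) (encodeNat k)) (factCert N)) = [true] := by
  have hps : ∀ p ∈ N.primeFactorsList, p.Prime := fun p hp => Nat.prime_of_mem_primeFactorsList hp
  obtain ⟨hcert, hheads⟩ := certTestFn_encLines_flatMap hps
  rw [factCertFn_eq_true_iff]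
  simp only [factCert, fstF_boolPair, sndF_boolPair, bitsToNat_encodeNat, decNil_encList, List.map_map,
    List.forall_mem_map]
  refine ⟨Nat.pos_of_ne_zero hN, ?_, fun p hp => ⟨?_, hheads p hp⟩, (certTestFn_eq_true_iff _).1 hcert⟩
  · have : (fun x => bitsToNat (encodeNat x)) = id := funext fun x => bitsToNat_encodeNat x
    rw [show (bitsToNat ∘ encodeNat) = id from this, List.map_id]
    exact Nat.prod_primeFactorsList hN
  · by_contra hle
    exact hNk ⟨p, (hps p hp).one_lt, Nat.le_of_not_lt hle, Nat.dvd_of_mem_primeFactorsList hp⟩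

end FactCoNP

/-! ### `FACT ∈ coNP` and the discharge -/

open FactCoNP

/-- The verifier's language. [cite: AroraBarakCC2009, Example 2.3] -/
def FactCoVer : Language Bool := {w | factCoVerFn w = [true]}

/-- **`FactCoVer ∈ P`.** [cite: AroraBarakCC2009, Example 2.3] -/
theorem FactCoVer_mem_P : FactCoVer ∈ P :=
  mem_P_of_mem_FP factCoVerFn_mem_FP _ fun _ => ⟨fun h => h, fun h => oneBit_factCoVerFn.eq_false_of_ne_true h⟩

/-- **pqc.S26, second half** (Pratt 1975; Arora–Barak 2009, Example 2.3). `FACT ∈ coNP`: the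
prime factorisation of `N` with Pratt certificates is a polynomial-size certificate of
non-membership checked in polynomial time by `FactCoVer`. [cite: Pratt1975, pp. 214–220] -/
theorem FACT_mem_coNP : FACT ∈ coNP := by
  show FACTᶜ ∈ NP
  refine ⟨FactCoVer, FactCoVer_mem_P, factCertPoly, fun x => ?_⟩
  change x ∉ FACT ↔ _
  rw [mem_FACT_iff]
  constructor
  · intro hx
    by_cases hval : x = renormFn x
    · obtain ⟨N, k, rfl⟩ := (eq_renorm_iff x).1 hval
      have hNk : (N, k) ∉ factSet := fun h => hx ⟨N, k, rfl, h⟩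
      rcases Nat.eq_zero_or_pos N with rfl | hN
      · refine ⟨[], Nat.zero_le _, ?_⟩
        show factCoVerFn _ = [true]
        rw [factCoVerFn_eq_true_iff]
        refine Or.inr (Or.inl ⟨by simp, ?_⟩)
        have : ¬ 2 ≤ k := fun hk => hNk ((zero_mem_factSet_iff k).2 hk)
        simpa using Nat.lt_of_not_le this
      · refine ⟨factCert N, ?_, ?_⟩
        · refine length_factCert_le_eval (by omega) ?_
          rw [length_boolPair, TM2Pass.length_encodeNat_eq_size]; omega
        · show factCoVerFn _ = [true]
          rw [factCoVerFn_eq_true_iff]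
          exact Or.inr (Or.inr (factCertFn_factCert (by omega) hNk))
    · refine ⟨[], Nat.zero_le _, ?_⟩
      show factCoVerFn _ = [true]
      rw [factCoVerFn_eq_true_iff]
      exact Or.inl hval
  · rintro ⟨y, -, hy⟩ ⟨N, k, rfl, hNk⟩
    change factCoVerFn _ = [true] at hy
    rw [factCoVerFn_eq_true_iff] at hy
    rcases hy with hval | ⟨hN0, hk⟩ | hcert
    · exact hval ((eq_renorm_iff _).2 ⟨N, k, rfl⟩)
    · simp only [fstF_boolPair, sndF_boolPair, bitsToNat_encodeNat] at hN0 hk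
      subst hN0
      exact absurd ((zero_mem_factSet_iff k).1 hNk) (by omega)
    · rw [factCertFn_eq_true_iff] at hcert
      simp only [bitsToNat_encodeNat] at hcert
      obtain ⟨-, hprod, hall, hvalid⟩ := hcert
      obtain ⟨d, h1, hdk, hdN⟩ := hNk
      refine not_dvd_of_prime_factorisation hprod (fun p hp => ?_) h1 hdk hdN
      obtain ⟨ps, hps, rfl⟩ := List.mem_map.1 hp
      exact ⟨(hall ps hps).1, hvalid.prime_of_mem_heads (hall ps hps).2⟩

/-- **pqc.S26 discharged**: `FACT ∈ NP ∩ coNP` (`FACT_mem_NP` of `FactoringNP.lean` and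
`FACT_mem_coNP`). [cite: Pratt1975, pp. 214–220] -/
theorem FACT_mem_NP_inter_coNP_holds : FACT_mem_NP_inter_coNP := ⟨FACT_mem_NP, FACT_mem_coNP⟩

/-! ### `PRIMES ∈ NP` -/

namespace PrimesNP

/-- **The verifier of primality** on `⟨x, Ls⟩`: `x` is a canonical numeral, `Ls` is a valid Pratt
certificate, and `⟦x⟧` is one of its heads. [cite: AroraBarakCC2009, Exercise 2.5] -/
noncomputable def primesVerFn : List Bool → List Bool :=
  andFn (eqPairFn ∘ fanoutFn fstF (norm ∘ fstF)) (andFn (certTestFn ∘ sndF) memHeadFn)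

/-- `primesVerFn ∈ FP`. [cite: AroraBarakCC2009, §1.3] -/
theorem primesVerFn_mem_FP : primesVerFn ∈ FP :=
  andFn_mem_FP (comp_mem_FP eqPairFn_mem_FP (fanoutFn_mem_FP fstF_mem_FP (comp_mem_FP norm_mem_FP fstF_mem_FP)))
    (andFn_mem_FP (comp_mem_FP certTestFn_mem_FP sndF_mem_FP) memHeadFn_mem_FP)

/-- `primesVerFn` is one-bit. [folklore] -/
theorem oneBit_primesVerFn : OneBit primesVerFn :=
  oneBit_andFn (oneBit_eqPairFn.comp _) (oneBit_andFn (oneBit_certTestFn.comp _) oneBit_memHeadFn)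

/-- Truth of the primality verifier on a pair. [cite: AroraBarakCC2009, Exercise 2.5] -/
theorem primesVerFn_eq_true_iff (x Ls : List Bool) :
    primesVerFn (boolPair x Ls) = [true] ↔
      x = encodeNat (bitsToNat x) ∧ Pratt.CertValid (linesOf Ls) ∧ bitsToNat x ∈ Pratt.heads (linesOf Ls) := by
  rw [primesVerFn, andFn_eq_true_iff (oneBit_eqPairFn.comp _) (oneBit_andFn (oneBit_certTestFn.comp _) oneBit_memHeadFn),
    andFn_eq_true_iff (oneBit_certTestFn.comp _) oneBit_memHeadFn]
  simp only [Function.comp_apply, fanoutFn_apply, fstF_boolPair, sndF_boolPair, eqPairFn_boolPair,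
    norm_eq_encodeNat, certTestFn_eq_true_iff, memHeadFn_eq_true_iff, mem_heads_linesOf_iff,
    List.singleton_inj, decide_eq_true_eq]

end PrimesNP

open PrimesNP

/-- The primality verifier's language. [cite: AroraBarakCC2009, Exercise 2.5] -/
def PrimesVer : Language Bool := {w | primesVerFn w = [true]}

/-- `PrimesVer ∈ P`. [cite: AroraBarakCC2009, Exercise 2.5] -/
theorem PrimesVer_mem_P : PrimesVer ∈ P :=
  mem_P_of_mem_FP primesVerFn_mem_FP _ fun _ => ⟨fun h => h, fun h => oneBit_primesVerFn.eq_false_of_ne_true h⟩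

/-- **Pratt's theorem: `PRIMES ∈ NP`.** Every prime `p` has a certificate (the lines of its Lucas
tree) of length `≤ 2 size p (24 size p + 10)`, checked in polynomial time by `PrimesVer`; a
certified numeral is prime by Lucas's criterion. [cite: Pratt1975, pp. 214–220] -/
theorem PRIMES_mem_NP : PRIMES ∈ NP := by
  refine ⟨PrimesVer, PrimesVer_mem_P, 2 * X * (24 * X + 10), fun x => ?_⟩
  constructor
  · rintro ⟨p, hp, rfl⟩
    have hp' : p.Prime := hp
    obtain ⟨hcert, hhead⟩ := certTestFn_encLines_lines hp'
    refine ⟨encLines (Pratt.lines p), ?_, ?_⟩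
    · show (encLines (Pratt.lines p)).length ≤ (2 * X * (24 * X + 10)).eval (encodeNat p).length
      rw [TM2Pass.length_encodeNat_eq_size]
      simpa using length_encLines_lines_le hp'
    · show primesVerFn (boolPair (encodeNat p) (encLines (Pratt.lines p))) = [true]
      rw [primesVerFn_eq_true_iff]
      simp only [bitsToNat_encodeNat]
      exact ⟨trivial, (certTestFn_eq_true_iff _).1 hcert, hhead⟩
  · rintro ⟨Ls, -, h⟩
    change primesVerFn _ = [true] at h
    rw [primesVerFn_eq_true_iff] at h
    obtain ⟨hx, hvalid, hhead⟩ := h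
    rw [hx]
    exact ⟨bitsToNat x, hvalid.prime_of_mem_heads hhead, rfl⟩

end Literature.Computability.QuantumComplexity
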